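import Summits.QuantumFields.BalabanUV.Beta.GAN24.LegChainPushBound
import Summits.QuantumFields.BalabanUV.Beta.GAN24.ThreeLegDoubleFreezeBlockL1
import Summits.QuantumFields.BalabanUV.Beta.GAN24.ThreeLegSupBoundBlockL1

/-!
# `BalabanUV.Beta.GAN24.LegPushBlockL1` — binder row G-an2-4 ∕ (CONV-C), W-slot, the (α-0) parity re-cut, located crux (Q-L-k₀)
# (RULING R-gan24p1-g36-1 (4)–(5); leaf-01 g74 W-2 (3) «the `_of_blockL1` twins one level up: YOURS as 2c», journal `CLAIMS.log` l.53845):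
# **THE ONE-PUSH BOUND AND THE (H1♮) WINDOW WITH THE KERNEL LEG IN BLOCK-ℓ¹** (OWNER `b2b-balaban-gan24-p1`, gen 36; part 2c of the dressed-leg side)

NOT IN PRINT; OUR BOOKKEEPING ([folklore]: leaf-01 g74's `LegStepPush.abs_legPush_bsum_inl_le` ∕ `locStencil₂_legPush_bsum` ∕
`LegChainPushBound.locStencil₂_legChain_bsumPow_of_envelopes` RE-RUN with the kernel leg's SUP envelope replaced by its BLOCK MASS, over the OWNER's block-ℓ¹ core
`ThreeLegDoubleFreezeBlockL1.abs_threeLeg_blockSum_le_of_blockL1` BY NAME; 0 `def`, 0 cited facts, 0 `def … : Prop`, 0 sorry).  HONEST FRAMING (cell contract, verbatim):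
«discharging `BetaPertH` makes Bałaban's UV stability UNCONDITIONAL — a real constructive-QFT result; it is NOT the continuum limit and NOT the Clay problem.»
HONEST DEPENDENCY (verbatim): «continuum YM on T⁴ ⇐ BetaPertH ∧ nine spine estimates (0/9 proved); BetaPertH ⇐ (D1) ∧ (D4) ∧ CAP+tail; G-an2-4 gates asym, D1 and NE2/3/4.»

WHY.  leaf-01 g74's carrier reads leaf-03's (H1♮) window object as ONE three-leg push of the block-summed table through the composite legs
(`LegChainPushBound.legChain_bsumPow_eq_smul_legPush_bsum`) and bounds it with all three legs in SUP currency.  For the DRESSED kernels `K♮ᴱ_m` the composite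
kernel leg `kChain (krow ∘ K♮ᴱ) m k` has no small sup envelope (the dressing's face jumps, `DressedLegSawtoothBlockL1`), but its BLOCK MASS at blocking `L = N^{k+1}` is
`T^B`-sized and `(k+1)`-linear (`DressedLegBlockL1Envelope.exists_legChain_blockL1_envelope`, `DressedLegMultiplierColumnEnvelope.exists_legChain_mmColumn_blockL1_envelope`).
This file is the carrier's last mile in that currency: the SAME conclusions as leaf-01's, the kernel-leg hypothesis relaxed from
`|ℓ α x′ f x| ≤ a_ρ·e^{−κ₀‖quo L x − x′‖∞}` to `Σ_{t ∈ box L} |ℓ α x′ f (L•c + t)| ≤ a_ρ·L^{d+1}·e^{−κ₀‖c − x′‖∞}` (every source block `c`).  The sup form implies the block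
form with the same `a_ρ` (`ThreeLegDoubleFreezeBlockL1.blockL1_of_sup`), so nothing is lost.

WHAT (generic `d`; leaf-01 g74's standing hypotheses and constants VERBATIM except `hl ↦ hl₁`):
* §1 **`abs_legPush_bsum_inl_le_of_blockL1`**, **`locStencil₂_legPush_bsum_of_blockL1`** — `LegStepPush` §2 with `hl₁` (v1.2, gen 39: the rows `hl₁ hW hq₂ hq₁ hq₁₂` are the two
  theorems' OWN displayed binders, same order and elaborated signatures as v1 ∕ v1.1 — as section variables their source statements were the text of leaf-01's sup-form
  `LegStepPush` theorems, which the gate's textual restatement check reads as twins); proof = leaf-01's proof with the summabilities fed the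
  crude domination `|ℓ| ≤ a_ρ·L^{d+1}·E` (`abs_le_blockSum`) and the estimate fed `abs_threeLeg_blockSum_le_of_blockL1`;
* §2 **`locStencil₂_legChain_bsumPow_of_envelopes_of_blockL1`** — the (H1♮) WINDOW modulo the composite legs' envelopes, kernel leg in block mass:
  `LocStencil₂ (legChain kc K N m (k+1) (bsumPow N (k+1) ∘ W)) (|∏ kc|·|Fib d|·(d+1)²·a_ρ·Jc·L^{d+1}·Zl(κ₀/(2(d+1)))) (κ₀/3/(6(d+1)))`.
Asserts NOTHING about Bałaban's tables; NOT (H1♮) (the dressed∕undressed split of the SLOT legs with the gauge pairings (leaf-01's (E-a)), the slot charges, the socket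
instantiation and the `θ < 1` arithmetic are other files); NEVER «G-an2-4 closed» as (CONV-C); NOT D1, NOT `BetaPertH`, NOT continuum, NOT Clay.  2026-08-23; no existing
file touched.
-/

noncomputable section

open Finset
open scoped BigOperators
open Literature.MathematicalPhysics.QuantumFieldTheory.LatticeForm (quo)
open Literature.MathematicalPhysics.QuantumFieldTheory.Balaban1983to89
open Literature.MathematicalPhysics.QuantumFieldTheory.Balaban1983to89.Beta
open B4ContourShift (supNorm abs_le_supNorm supNorm_nonneg)
open B4Reflection242 (supNorm_le_of_forall supNorm_add_le)
open B12Sec2to5 (l1 l1_nonneg)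
open ExpKernelCalculus (MKer Decays comp Zl Zl_nonneg Zl_pos)
open OneStepResolventKernel (Fib)
open OneStepKernelFamily (colH)
open AffineAveraging (Site box toSite)
open AveragingContours (blk)
open BalabanCompositeJets (LocStencil₂ LocStencil₂.nonneg)
open BalabanStepW2 (locStencil₂_smul')
open Summit.QuantumFields.BalabanUV.Beta.GAN24.BiStencilZeroMode (Tab)
open Summit.QuantumFields.BalabanUV.Beta.GAN24.Push4 (vertexW vertexW_apply vertex2W)
open Summit.QuantumFields.BalabanUV.Beta.GAN24.Lin4LegTower (bsum bsum_apply)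
open Summit.QuantumFields.BalabanUV.Beta.GAN24.Lin4LegTowerUnroll (bsumPow)
open Summit.QuantumFields.BalabanUV.Beta.GAN24.ThreeLegDoubleFreezeSummable (summable_slotLayer summable_kernelLayer locStencil₂_of_env_bound)
open Summit.QuantumFields.BalabanUV.Beta.GAN24.ThreeLegDoubleFreezeBlockL1 (abs_threeLeg_blockSum_le_of_blockL1)
open Summit.QuantumFields.BalabanUV.Beta.GAN24.ThreeLegSupBoundBlockL1 (abs_le_blockSum)
open Summit.QuantumFields.BalabanUV.Beta.GAN24.LegStepPush (krow legPush legPush_inl legPush_inr vertex2W_bsum_entry supNorm_sub_comm)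
open Summit.QuantumFields.BalabanUV.Beta.GAN24.LegChainPush (kChain)
open Summit.QuantumFields.BalabanUV.Beta.GAN24.LegChainPushBound (legChain_bsumPow_eq_smul_legPush_bsum)

namespace Summit.QuantumFields.BalabanUV.Beta.GAN24.LegPushBlockL1

variable {d : ℕ}

/-! ## §1 The one-push bound with the kernel leg in block-ℓ¹ -/

section OnePush

variable {L : ℕ} {κ₀ δ a a' aρ C g : ℝ}
  {l : Fin (d + 1) → (Fin (d + 1) → ℤ) → Fib d → (Fin (d + 1) → ℤ) → ℝ}
  {r : Fin (d + 1) → (Fin (d + 1) → ℤ) → Fin (d + 1) → (Fin (d + 1) → ℤ) → ℝ} {W : Tab d}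
  (hL : 1 ≤ L) (hκ : 0 < κ₀) (hδ : 0 < δ) (hgap : κ₀ ≤ δ / 6 * L)
  (ha : 0 ≤ a) (ha' : 0 ≤ a') (haρ : 0 ≤ aρ) (hg : 0 ≤ g)
  (hr : ∀ μ y κ v, |r μ y κ v| ≤ a * Real.exp (-(κ₀ * supNorm (quo L v - y))))
  (hr' : ∀ μ y κ v i, |r μ y κ (v + Pi.single i 1) - r μ y κ v| ≤ a' * Real.exp (-(κ₀ * supNorm (quo L v - y))))

include hL hκ hδ hgap ha ha' haρ hg hr hr' in
/-- NOT IN PRINT; OUR BOOKKEEPING.  **THE ONE-PUSH ENTRY BOUND, KERNEL LEG IN BLOCK-ℓ¹** — leaf-01 g74's `LegStepPush.abs_legPush_bsum_inl_le` VERBATIM (statement and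
constant) except that the kernel leg `ℓ` is only asked to have block mass `Σ_{t ∈ box L} |ℓ α x′ f (L•c + t)| ≤ a_ρ·L^{d+1}·e^{−κ₀‖c − x′‖∞}`:
`|legPush ℓ r (bsum L ∘ W) κ u κ′ u′ x′ y (inl α) b| ≤ |Fib d|·(d+1)²·a_ρ·Jc·L^{d+1}·Zl(κ₀/(2(d+1)))·e^{−(κ₀/18)(‖u′−u‖∞+‖x′−u‖∞+‖y−u‖∞)}`. -/
theorem abs_legPush_bsum_inl_le_of_blockL1
    (hl₁ : ∀ α x' f c, ∑ t ∈ box (d + 1) L, |l α x' f ((L : ℤ) • c + toSite t)|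
      ≤ aρ * (L : ℝ) ^ (d + 1) * Real.exp (-(κ₀ * supNorm (c - x'))))
    (hW : LocStencil₂ W C δ)
    (hq₂ : ∀ κ₁ v κ₂ x p f b, |∑' v', W κ₁ v κ₂ v' x p f b| ≤ g * Real.exp (-δ * (l1 (x - v) + l1 (p - v))))
    (hq₁ : ∀ κ₁ κ₂ v' x p f b, |∑' v, W κ₁ v κ₂ v' x p f b| ≤ g * Real.exp (-δ * (l1 (x - v') + l1 (p - v'))))
    (hq₁₂ : ∀ κ₁ κ₂ x p f b, |∑' v, ∑' v', W κ₁ v κ₂ v' x p f b| ≤ g * Real.exp (-δ * l1 (p - x)))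
    (κ : Fin (d + 1)) (u : Fin (d + 1) → ℤ) (κ' : Fin (d + 1)) (u' : Fin (d + 1) → ℤ) (x' y : Fin (d + 1) → ℤ)
    (α : Fin (d + 1)) (b : Fib d) :
    |legPush l r (fun κ₁ v κ₂ v' => bsum L (W κ₁ v κ₂ v')) κ u κ' u' x' y (Sum.inl α) b|
      ≤ (Fintype.card (Fib d) : ℝ) * ((d : ℝ) + 1) ^ 2 *
        (aρ * ((Real.exp κ₀ * Zl (d + 1) (δ / 6)) *
          (a' ^ 2 * C * Real.exp κ₀ ^ 2 * (2 / (δ / 6) * Zl (d + 1) (δ / 6 / 2)) ^ 2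
            + 2 * (a * a' * g * Real.exp κ₀ * (2 / (δ / 6) * Zl (d + 1) (δ / 6 / 2))) + a ^ 2 * g)) *
        ((L : ℝ) ^ (d + 1) * Zl (d + 1) (κ₀ / (2 * ((d : ℝ) + 1))))) *
        Real.exp (-(κ₀ / 18) * (supNorm (u' - u) + supNorm (x' - u) + supNorm (y - u))) := by
  have hC : 0 ≤ C := hW.nonneg
  haveI : NeZero L := ⟨by omega⟩
  -- the crude pointwise domination of the kernel leg by its block mass (for the summabilities only)
  have hlx : ∀ α₀ (x₀ : Fin (d + 1) → ℤ) f x, |l α₀ x₀ f x| ≤ aρ * (L : ℝ) ^ (d + 1) * Real.exp (-(κ₀ * supNorm (quo L x - x₀))) :=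
    fun α₀ x₀ f x => (abs_le_blockSum hL (fun x => l α₀ x₀ f x) x).trans (hl₁ α₀ x₀ f (blk L x))
  have haρL : 0 ≤ aρ * (L : ℝ) ^ (d + 1) := by positivity
  have hZ := Zl_nonneg (D := d + 1) (show 0 < δ / 6 by positivity)
  have hZ' := Zl_nonneg (D := d + 1) (show 0 < δ / 6 / 2 by positivity)
  have hZκ := Zl_nonneg (D := d + 1) (show 0 < κ₀ / (2 * ((d : ℝ) + 1)) by positivity)
  set K : ℝ := aρ * ((Real.exp κ₀ * Zl (d + 1) (δ / 6)) *
      (a' ^ 2 * C * Real.exp κ₀ ^ 2 * (2 / (δ / 6) * Zl (d + 1) (δ / 6 / 2)) ^ 2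
        + 2 * (a * a' * g * Real.exp κ₀ * (2 / (δ / 6) * Zl (d + 1) (δ / 6 / 2))) + a ^ 2 * g)) *
      ((L : ℝ) ^ (d + 1) * Zl (d + 1) (κ₀ / (2 * ((d : ℝ) + 1)))) with hK
  have hK0 : 0 ≤ K := by rw [hK]; positivity
  set S : ℝ := supNorm (u' - u) + supNorm (x' - u) + supNorm (y - u) with hS
  -- the per-fibre kernel layers and their core bounds
  set J : Fib d → Fin (d + 1) → Fin (d + 1) → (Fin (d + 1) → ℤ) → (Fin (d + 1) → ℤ) → (Fin (d + 1) → ℤ) → ℝ :=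
    fun f κ₁ κ₂ c c' x => ∑' v, r κ c κ₁ v * ∑' v', r κ' c' κ₂ v' * ∑ t ∈ box (d + 1) L, W κ₁ v κ₂ v' x ((L : ℤ) • y + toSite t) f b with hJ
  -- ... but the swapped summand has the SLOT DIRECTIONS swapped too; treat both summands with their own direction labels:
  set J₁ : Fib d → Fin (d + 1) → Fin (d + 1) → (Fin (d + 1) → ℤ) → ℝ :=
    fun f κ₁ κ₂ x => ∑' v, r κ u κ₁ v * ∑' v', r κ' u' κ₂ v' * ∑ t ∈ box (d + 1) L, W κ₁ v κ₂ v' x ((L : ℤ) • y + toSite t) f b with hJ₁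
  set J₂ : Fib d → Fin (d + 1) → Fin (d + 1) → (Fin (d + 1) → ℤ) → ℝ :=
    fun f κ₁ κ₂ x => ∑' v, r κ' u' κ₁ v * ∑' v', r κ u κ₂ v' * ∑ t ∈ box (d + 1) L, W κ₁ v κ₂ v' x ((L : ℤ) • y + toSite t) f b with hJ₂
  have core₁ : ∀ f κ₁ κ₂, (Summable fun x => l α x' f x * J₁ f κ₁ κ₂ x) ∧
      |∑' x, l α x' f x * J₁ f κ₁ κ₂ x| ≤ K * Real.exp (-(κ₀ / 6) * (supNorm (u' - u) + supNorm (x' - u) + supNorm (y - u))) := by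
    intro f κ₁ κ₂
    refine ⟨summable_kernelLayer (h₁ := fun v => r κ u κ₁ v) (h₂ := fun v' => r κ' u' κ₂ v') (ρ := fun x => l α x' f x)
        (W := fun v v' x q => W κ₁ v κ₂ v' x q f b) (c₁ := u) (c₂ := u') (c₃ := x') (c₄ := y)
        hL hκ hδ hgap ha ha' haρL hC hg (fun v => hr κ u κ₁ v) (fun v i => hr' κ u κ₁ v i) (fun v' => hr κ' u' κ₂ v') (fun v' i => hr' κ' u' κ₂ v' i)
        (fun x => hlx α x' f x) (fun v v' x q => hW κ₁ v κ₂ v' x q f b) (fun v x q => hq₂ κ₁ v κ₂ x q f b) (fun v' x q => hq₁ κ₁ κ₂ v' x q f b)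
        (fun x q => hq₁₂ κ₁ κ₂ x q f b), ?_⟩
    have h := abs_threeLeg_blockSum_le_of_blockL1 (h₁ := fun v => r κ u κ₁ v) (h₂ := fun v' => r κ' u' κ₂ v') (ρ := fun x => l α x' f x)
        (W := fun v v' x q => W κ₁ v κ₂ v' x q f b) (c₁ := u) (c₂ := u') (c₃ := x') (c₄ := y)
        hL hκ hδ hgap ha ha' haρ hC hg (fun v => hr κ u κ₁ v) (fun v i => hr' κ u κ₁ v i) (fun v' => hr κ' u' κ₂ v') (fun v' i => hr' κ' u' κ₂ v' i)
        (fun c => hl₁ α x' f c) (fun v v' x q => hW κ₁ v κ₂ v' x q f b) (fun v x q => hq₂ κ₁ v κ₂ x q f b) (fun v' x q => hq₁ κ₁ κ₂ v' x q f b)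
        (fun x q => hq₁₂ κ₁ κ₂ x q f b)
    rw [hK]; exact h.trans (le_of_eq (by ring))
  have core₂ : ∀ f κ₁ κ₂, (Summable fun x => l α x' f x * J₂ f κ₁ κ₂ x) ∧
      |∑' x, l α x' f x * J₂ f κ₁ κ₂ x| ≤ K * Real.exp (-(κ₀ / 6) * (supNorm (u - u') + supNorm (x' - u') + supNorm (y - u'))) := by
    intro f κ₁ κ₂
    refine ⟨summable_kernelLayer (h₁ := fun v => r κ' u' κ₁ v) (h₂ := fun v' => r κ u κ₂ v') (ρ := fun x => l α x' f x)
        (W := fun v v' x q => W κ₁ v κ₂ v' x q f b) (c₁ := u') (c₂ := u) (c₃ := x') (c₄ := y)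
        hL hκ hδ hgap ha ha' haρL hC hg (fun v => hr κ' u' κ₁ v) (fun v i => hr' κ' u' κ₁ v i) (fun v' => hr κ u κ₂ v') (fun v' i => hr' κ u κ₂ v' i)
        (fun x => hlx α x' f x) (fun v v' x q => hW κ₁ v κ₂ v' x q f b) (fun v x q => hq₂ κ₁ v κ₂ x q f b) (fun v' x q => hq₁ κ₁ κ₂ v' x q f b)
        (fun x q => hq₁₂ κ₁ κ₂ x q f b), ?_⟩
    have h := abs_threeLeg_blockSum_le_of_blockL1 (h₁ := fun v => r κ' u' κ₁ v) (h₂ := fun v' => r κ u κ₂ v') (ρ := fun x => l α x' f x)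
        (W := fun v v' x q => W κ₁ v κ₂ v' x q f b) (c₁ := u') (c₂ := u) (c₃ := x') (c₄ := y)
        hL hκ hδ hgap ha ha' haρ hC hg (fun v => hr κ' u' κ₁ v) (fun v i => hr' κ' u' κ₁ v i) (fun v' => hr κ u κ₂ v') (fun v' i => hr' κ u κ₂ v' i)
        (fun c => hl₁ α x' f c) (fun v v' x q => hW κ₁ v κ₂ v' x q f b) (fun v x q => hq₂ κ₁ v κ₂ x q f b) (fun v' x q => hq₁ κ₁ κ₂ v' x q f b)
        (fun x q => hq₁₂ κ₁ κ₂ x q f b)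
    rw [hK]; exact h.trans (le_of_eq (by ring))
  -- the two decays against the symmetric rate `κ₀/18`
  have hdec₁ : Real.exp (-(κ₀ / 6) * (supNorm (u' - u) + supNorm (x' - u) + supNorm (y - u))) ≤ Real.exp (-(κ₀ / 18) * S) := by
    rw [Real.exp_le_exp, hS]
    have := supNorm_nonneg (u' - u); have := supNorm_nonneg (x' - u); have := supNorm_nonneg (y - u)
    nlinarith
  have hdec₂ : Real.exp (-(κ₀ / 6) * (supNorm (u - u') + supNorm (x' - u') + supNorm (y - u'))) ≤ Real.exp (-(κ₀ / 18) * S) := by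
    rw [Real.exp_le_exp, hS]
    have h1 := supNorm_add_le (x' - u') (u' - u)
    have h2 := supNorm_add_le (y - u') (u' - u)
    rw [show x' - u' + (u' - u) = x' - u by abel] at h1
    rw [show y - u' + (u' - u) = y - u by abel] at h2
    have h3 := supNorm_sub_comm u u'
    have := supNorm_nonneg (u - u'); have := supNorm_nonneg (x' - u'); have := supNorm_nonneg (y - u')
    nlinarith
  -- the entry as a finite sum of per-fibre kernel layers
  have eV : ∀ x f, (1 / 2 : ℝ) * (vertex2W r (fun κ₁ v κ₂ v' => bsum L (W κ₁ v κ₂ v')) κ u κ' u' x y f b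
      + vertex2W r (fun κ₁ v κ₂ v' => bsum L (W κ₁ v κ₂ v')) κ' u' κ u x y f b)
      = ∑ κ₁, ∑ κ₂, (1 / 2 : ℝ) * (J₁ f κ₁ κ₂ x + J₂ f κ₁ κ₂ x) := by
    intro x f
    rw [vertex2W_bsum_entry hL hκ hδ hgap ha ha' hg hr hr' hW hq₂, vertex2W_bsum_entry hL hκ hδ hgap ha ha' hg hr hr' hW hq₂]
    rw [hJ₁, hJ₂]
    simp only [← Finset.sum_add_distrib, Finset.mul_sum]
  have eE : legPush l r (fun κ₁ v κ₂ v' => bsum L (W κ₁ v κ₂ v')) κ u κ' u' x' y (Sum.inl α) b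
      = ∑ f, ∑ κ₁, ∑ κ₂, ∑' x, (1 / 2 : ℝ) * (l α x' f x * J₁ f κ₁ κ₂ x + l α x' f x * J₂ f κ₁ κ₂ x) := by
    rw [legPush_inl]
    have e1 : ∀ x, ∑ f, l α x' f x * ((1 / 2 : ℝ) * (vertex2W r (fun κ₁ v κ₂ v' => bsum L (W κ₁ v κ₂ v')) κ u κ' u' x y f b
        + vertex2W r (fun κ₁ v κ₂ v' => bsum L (W κ₁ v κ₂ v')) κ' u' κ u x y f b))
        = ∑ f, ∑ κ₁, ∑ κ₂, (1 / 2 : ℝ) * (l α x' f x * J₁ f κ₁ κ₂ x + l α x' f x * J₂ f κ₁ κ₂ x) := by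
      intro x
      refine Finset.sum_congr rfl fun f _ => ?_
      rw [eV x f, Finset.mul_sum]
      refine Finset.sum_congr rfl fun κ₁ _ => ?_
      rw [Finset.mul_sum]
      refine Finset.sum_congr rfl fun κ₂ _ => ?_
      ring
    simp_rw [e1]
    have hSx : ∀ f κ₁ κ₂, Summable fun x => (1 / 2 : ℝ) * (l α x' f x * J₁ f κ₁ κ₂ x + l α x' f x * J₂ f κ₁ κ₂ x) :=
      fun f κ₁ κ₂ => ((core₁ f κ₁ κ₂).1.add (core₂ f κ₁ κ₂).1).mul_left _
    rw [Summable.tsum_finsetSum (fun f _ => summable_sum fun κ₁ _ => summable_sum fun κ₂ _ => hSx f κ₁ κ₂)]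
    refine Finset.sum_congr rfl fun f _ => ?_
    rw [Summable.tsum_finsetSum (fun κ₁ _ => summable_sum fun κ₂ _ => hSx f κ₁ κ₂)]
    refine Finset.sum_congr rfl fun κ₁ _ => ?_
    exact Summable.tsum_finsetSum (fun κ₂ _ => hSx f κ₁ κ₂)
  rw [eE]
  -- per fibre triple: `½(|A| + |B|) ≤ K·e^{−(κ₀/18)S}`
  have hterm : ∀ f κ₁ κ₂, |∑' x, (1 / 2 : ℝ) * (l α x' f x * J₁ f κ₁ κ₂ x + l α x' f x * J₂ f κ₁ κ₂ x)| ≤ K * Real.exp (-(κ₀ / 18) * S) := by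
    intro f κ₁ κ₂
    rw [tsum_mul_left, (core₁ f κ₁ κ₂).1.tsum_add (core₂ f κ₁ κ₂).1, abs_mul, abs_of_pos (by norm_num : (0 : ℝ) < 1 / 2)]
    have h1 := (core₁ f κ₁ κ₂).2.trans (mul_le_mul_of_nonneg_left hdec₁ hK0)
    have h2 := (core₂ f κ₁ κ₂).2.trans (mul_le_mul_of_nonneg_left hdec₂ hK0)
    have h12 := (abs_add_le _ _).trans (add_le_add h1 h2)
    linarith
  calc |∑ f, ∑ κ₁, ∑ κ₂, ∑' x, (1 / 2 : ℝ) * (l α x' f x * J₁ f κ₁ κ₂ x + l α x' f x * J₂ f κ₁ κ₂ x)|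
      ≤ ∑ f, |∑ κ₁, ∑ κ₂, ∑' x, (1 / 2 : ℝ) * (l α x' f x * J₁ f κ₁ κ₂ x + l α x' f x * J₂ f κ₁ κ₂ x)| := Finset.abs_sum_le_sum_abs _ _
    _ ≤ ∑ f, ∑ κ₁, |∑ κ₂, ∑' x, (1 / 2 : ℝ) * (l α x' f x * J₁ f κ₁ κ₂ x + l α x' f x * J₂ f κ₁ κ₂ x)| :=
        Finset.sum_le_sum fun f _ => Finset.abs_sum_le_sum_abs _ _
    _ ≤ ∑ f, ∑ κ₁, ∑ κ₂, |∑' x, (1 / 2 : ℝ) * (l α x' f x * J₁ f κ₁ κ₂ x + l α x' f x * J₂ f κ₁ κ₂ x)| :=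
        Finset.sum_le_sum fun f _ => Finset.sum_le_sum fun κ₁ _ => Finset.abs_sum_le_sum_abs _ _
    _ ≤ ∑ _f : Fib d, ∑ _κ₁ : Fin (d + 1), ∑ _κ₂ : Fin (d + 1), K * Real.exp (-(κ₀ / 18) * S) :=
        Finset.sum_le_sum fun f _ => Finset.sum_le_sum fun κ₁ _ => Finset.sum_le_sum fun κ₂ _ => hterm f κ₁ κ₂
    _ = _ := by
        simp only [Finset.sum_const, Finset.card_univ, Fintype.card_fin, nsmul_eq_mul, hK, hS]
        push_cast; ring

include hL hκ hδ hgap ha ha' haρ hg hr hr' in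
/-- NOT IN PRINT; OUR BOOKKEEPING.  **THE ONE-PUSH `LocStencil₂` BOUND, KERNEL LEG IN BLOCK-ℓ¹** — leaf-01 g74's `LegStepPush.locStencil₂_legPush_bsum` with `hl ↦ hl₁`:
`LocStencil₂ (legPush ℓ r (bsum L ∘ W)) (|Fib d|·(d+1)²·a_ρ·Jc·L^{d+1}·Zl(κ₀/(2(d+1)))) (κ₀/(18(d+1)))`. -/
theorem locStencil₂_legPush_bsum_of_blockL1
    (hl₁ : ∀ α x' f c, ∑ t ∈ box (d + 1) L, |l α x' f ((L : ℤ) • c + toSite t)|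
      ≤ aρ * (L : ℝ) ^ (d + 1) * Real.exp (-(κ₀ * supNorm (c - x'))))
    (hW : LocStencil₂ W C δ)
    (hq₂ : ∀ κ₁ v κ₂ x p f b, |∑' v', W κ₁ v κ₂ v' x p f b| ≤ g * Real.exp (-δ * (l1 (x - v) + l1 (p - v))))
    (hq₁ : ∀ κ₁ κ₂ v' x p f b, |∑' v, W κ₁ v κ₂ v' x p f b| ≤ g * Real.exp (-δ * (l1 (x - v') + l1 (p - v'))))
    (hq₁₂ : ∀ κ₁ κ₂ x p f b, |∑' v, ∑' v', W κ₁ v κ₂ v' x p f b| ≤ g * Real.exp (-δ * l1 (p - x))) :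
    LocStencil₂ (legPush l r (fun κ₁ v κ₂ v' => bsum L (W κ₁ v κ₂ v')))
      ((Fintype.card (Fib d) : ℝ) * ((d : ℝ) + 1) ^ 2 *
        (aρ * ((Real.exp κ₀ * Zl (d + 1) (δ / 6)) *
          (a' ^ 2 * C * Real.exp κ₀ ^ 2 * (2 / (δ / 6) * Zl (d + 1) (δ / 6 / 2)) ^ 2
            + 2 * (a * a' * g * Real.exp κ₀ * (2 / (δ / 6) * Zl (d + 1) (δ / 6 / 2))) + a ^ 2 * g)) *
        ((L : ℝ) ^ (d + 1) * Zl (d + 1) (κ₀ / (2 * ((d : ℝ) + 1))))))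
      (κ₀ / 3 / (6 * ((d : ℝ) + 1))) := by
  have hC : 0 ≤ C := hW.nonneg
  have hZ := Zl_nonneg (D := d + 1) (show 0 < δ / 6 by positivity)
  have hZ' := Zl_nonneg (D := d + 1) (show 0 < δ / 6 / 2 by positivity)
  have hZκ := Zl_nonneg (D := d + 1) (show 0 < κ₀ / (2 * ((d : ℝ) + 1)) by positivity)
  refine locStencil₂_of_env_bound (by positivity) (by positivity) fun κ u κ' u' x z a₀ b => ?_
  rw [show -(κ₀ / 3 / 6) = -(κ₀ / 18) by ring]
  rcases a₀ with α | ν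
  · exact abs_legPush_bsum_inl_le_of_blockL1 hL hκ hδ hgap ha ha' haρ hg hr hr' hl₁ hW hq₂ hq₁ hq₁₂ κ u κ' u' x z α b
  · rw [legPush_inr, abs_zero]; positivity

end OnePush

/-! ## §2 The (H1♮) window modulo the composite legs' envelopes, kernel leg in block-ℓ¹ -/

section Window

variable {K : ℕ → MKer (d + 1) (Fib d)} {N : ℕ} {kc : ℕ → ℝ} {W : Tab d} {C δ : ℝ}
variable {L : ℕ} {κ₀ a a' aρ g : ℝ}

/-- NOT IN PRINT; OUR BOOKKEEPING.  **THE (H1♮) WINDOW MODULO THE COMPOSITE LEGS' ENVELOPES — KERNEL LEG IN BLOCK MASS.**  leaf-01 g74's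
`LegChainPushBound.locStencil₂_legChain_bsumPow_of_envelopes` VERBATIM (kernels `K j` decaying at positive rates, `N ≥ 1`, `LocStencil₂ W C δ`, the three slot-charge rows
bounded by `g`, the composite slot legs `Push4Iter.legChain (colH ∘ K) m k` with sup ∕ unit-gradient envelopes `a`, `a′` at blocking `L = N^{k+1}`, `0 < κ₀ ≤ (δ/6)·L`) EXCEPT
that the composite kernel leg `kChain (krow ∘ K) m k` is only asked to have BLOCK MASS `Σ_{t ∈ box L} |kChain … α x′ f (L•c + t)| ≤ a_ρ·L^{d+1}·e^{−κ₀‖c − x′‖∞}`; SAME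
conclusion `LocStencil₂ (legChain kc K N m (k+1) (bsumPow N (k+1) ∘ W)) (|∏ kc|·|Fib d|·(d+1)²·a_ρ·Jc·L^{d+1}·Zl(κ₀/(2(d+1)))) (κ₀/3/(6(d+1)))`.  For the dressed kernels the
OWNER's `DressedLegBlockL1Envelope` ∕ `DressedLegMultiplierColumnEnvelope` supply `a_ρ·L^{d+1} = K·(k+1)·L^{−1}` (d = 3), one power of `L` below any sup reading. -/
theorem locStencil₂_legChain_bsumPow_of_envelopes_of_blockL1 (hN : 1 ≤ N) (hK : ∀ j, ∃ C m : ℝ, 0 < m ∧ Decays (K j) C m) (hW : LocStencil₂ W C δ)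
    (hδ : 0 < δ) (m k : ℕ) (hL : L = N ^ (k + 1)) (hκ : 0 < κ₀) (hgap : κ₀ ≤ δ / 6 * L) (ha : 0 ≤ a) (ha' : 0 ≤ a') (haρ : 0 ≤ aρ) (hg : 0 ≤ g)
    (hr : ∀ μ y κ v, |Push4Iter.legChain (fun j => colH (K j) N) m k μ y κ v| ≤ a * Real.exp (-(κ₀ * supNorm (quo L v - y))))
    (hr' : ∀ μ y κ v i, |Push4Iter.legChain (fun j => colH (K j) N) m k μ y κ (v + Pi.single i 1) - Push4Iter.legChain (fun j => colH (K j) N) m k μ y κ v|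
      ≤ a' * Real.exp (-(κ₀ * supNorm (quo L v - y))))
    (hl₁ : ∀ α x' f c, ∑ t ∈ box (d + 1) L, |kChain (fun j => krow (K j) N) m k α x' f ((L : ℤ) • c + toSite t)|
      ≤ aρ * (L : ℝ) ^ (d + 1) * Real.exp (-(κ₀ * supNorm (c - x'))))
    (hq₂ : ∀ κ₁ v κ₂ x p f b, |∑' v', W κ₁ v κ₂ v' x p f b| ≤ g * Real.exp (-δ * (l1 (x - v) + l1 (p - v))))
    (hq₁ : ∀ κ₁ κ₂ v' x p f b, |∑' v, W κ₁ v κ₂ v' x p f b| ≤ g * Real.exp (-δ * (l1 (x - v') + l1 (p - v'))))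
    (hq₁₂ : ∀ κ₁ κ₂ x p f b, |∑' v, ∑' v', W κ₁ v κ₂ v' x p f b| ≤ g * Real.exp (-δ * l1 (p - x))) :
    LocStencil₂ (Lin4LegTowerUnroll.legChain kc K N m (k + 1) (fun κ u κ' u' => bsumPow N (k + 1) (W κ u κ' u')))
      (|∏ j ∈ Finset.range (k + 1), kc (m + j)| *
        ((Fintype.card (Fib d) : ℝ) * ((d : ℝ) + 1) ^ 2 *
          (aρ * ((Real.exp κ₀ * Zl (d + 1) (δ / 6)) *
            (a' ^ 2 * C * Real.exp κ₀ ^ 2 * (2 / (δ / 6) * Zl (d + 1) (δ / 6 / 2)) ^ 2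
              + 2 * (a * a' * g * Real.exp κ₀ * (2 / (δ / 6) * Zl (d + 1) (δ / 6 / 2))) + a ^ 2 * g)) *
          ((L : ℝ) ^ (d + 1) * Zl (d + 1) (κ₀ / (2 * ((d : ℝ) + 1)))))))
      (κ₀ / 3 / (6 * ((d : ℝ) + 1))) := by
  have hL1 : 1 ≤ L := by rw [hL]; exact Nat.one_le_pow _ _ hN
  rw [legChain_bsumPow_eq_smul_legPush_bsum hN hK hW hδ m k, ← hL]
  exact locStencil₂_smul' _ (locStencil₂_legPush_bsum_of_blockL1 hL1 hκ hδ hgap ha ha' haρ hg hr hr' hl₁ hW hq₂ hq₁ hq₁₂)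

end Window

end Summit.QuantumFields.BalabanUV.Beta.GAN24.LegPushBlockL1

end
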